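import Literature.AnabelianGeometry.SemiGraphs.TemperedReconstruction
import HarnessLib

/-!
# Strictly coherent semi-graphs of anabelioids (local presentation) and splitting over `G_S`

[IUTchI] Remark 2.5.3 (i) (T3) (Mochizuki, *Inter-universal Teichmüller theory I*, p. 53)
[cite: Mochizuki2012, IUTchI Rem. 2.5.3(i)(T3) p.53]: a semi-graph of anabelioids is *strictly
coherent* if it is coherent (Def. 2.3 (iii) of [SemiAnbd]) and "each of the profinite groups
associated to components `c` … is topologically generated by `N` generators, for some positive integer
`N` that is independent of `c`"; "if `G` is finite and coherent, then it is strictly coherent". Typed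
here over the local presentation `ProfiniteSemiGraph` (`TemperedCoverings.lean`) as the mirror of
`SemiGraphOfAnabelioids.IsStrictlyCoherent` (`Coverticial.lean`, abc-iut-L3-t1; TODO-merge).

Also: `CovObj.UniformSplittingAt S` — the instance at one tempered object `S` of the named fact
`UniformSplitting` (`TemperedReconstruction.lean`: the covering-construction sentence of the proof
of [SemiAnbd] Prop. 3.6 (v), p. 40 [cite: MochizukiSemiAnbd2006, Prop 3.6(v) p.40]), so that the
strictly coherent case can be discharged and consumed per `S` (companion proof file
`UniformSplittingStrictlyCoherentProofs`).
-/

namespace Literature.AnabelianGeometry.SemiGraphs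

namespace ProfiniteSemiGraph

universe u

variable (𝒢 : ProfiniteSemiGraph.{u})

/-- **[IUTchI] Remark 2.5.3 (i) (T3)**, *strictly coherent* (local presentation): coherent, and the
vertex and edge groups `Π_v`, `Π_e` are all topologically generated by at most `N` elements for one
`N ≥ 1` independent of the component (mirror of `SemiGraphOfAnabelioids.IsStrictlyCoherent`).
[cite: Mochizuki2012, IUTchI Rem. 2.5.3(i)(T3) p.53] -/
@[mk_iff] structure IsStrictlyCoherent : Prop where
  /-- coherent ([SemiAnbd] Def. 2.3 (iii)) -/
  isCoherent : 𝒢.IsCoherent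
  /-- a uniform bound on the number of topological generators of all `Π_v`, `Π_e` -/
  exists_bound : ∃ N : ℕ, 1 ≤ N ∧
    (∀ v : 𝒢.graph.Vertex, ∃ s : Finset (𝒢.Gv v), s.card ≤ N ∧
      (Subgroup.closure (s : Set (𝒢.Gv v))).topologicalClosure = ⊤) ∧
    ∀ e : 𝒢.graph.Edge, ∃ s : Finset (𝒢.Ge e), s.card ≤ N ∧
      (Subgroup.closure (s : Set (𝒢.Ge e))).topologicalClosure = ⊤

variable {𝒢}

/-- The instance of the named fact `UniformSplitting` ([SemiAnbd] proof of Prop. 3.6 (v), p. 40: "there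
exists a finite étale covering `H~ → G` whose pull-back to `G'` splits the restrictions of `H → G'` to
each of the `G'_{c'}`") at ONE object `S` of `B^cov(G)`: every connected component of every finite
object `H` of `B^cov(G_S)` is split, constituent by constituent, by the pull-back to `G_S` of some
finite object of `B^cov(G)` with nonempty fibres. (`UniformSplitting` says this for all tempered `S`
over all `G` as in Prop. 3.6, coherent.) [cite: MochizukiSemiAnbd2006, Prop 3.6(v) p.40] -/
def CovObj.UniformSplittingAt (S : CovObj 𝒢) : Prop :=
  ∀ (H : CovObj S.coveringGraph), H.IsFinite →
    ∀ p : H.Point, ∃ F : CovObj 𝒢, F.IsFinite ∧ F.HasNonemptyFibres ∧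
      ∀ q : H.Point, H.SameComponent p q → (S.coveringHom.covPullback.obj F).SplitsAt H q

/-- `UniformSplitting` is the conjunction of its instances. [cite: MochizukiSemiAnbd2006, Prop 3.6(v) p.40] -/
theorem uniformSplitting_iff :
    UniformSplitting.{u} ↔ ∀ (𝒢 : ProfiniteSemiGraph.{u}), 𝒢.Prop36Hypotheses → 𝒢.IsCoherent →
      ∀ S : CovObj 𝒢, S.IsTempered → S.UniformSplittingAt :=
  Iff.rfl

end ProfiniteSemiGraph

end Literature.AnabelianGeometry.SemiGraphs
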